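import Summits.Ventures.YMGap.RobustBall.CentreProjectionLink
import Summits.Ventures.YMGap.RobustBall.CentreTubeTierOne
import HarnessLib

/-!
# RobustBall/CentreTubeLink — THE CENTRE TUBE WITH LINK ROWS: the class `IsFluxLocalL m s b`, and the QUANTITATIVE tier-1 cell
# `AreaLawCentreTubeFR N d β ε₀ ε₁ r` whenever `2(d−1)N|β| + √N ε₁ < 1` (no counting constant)

HONEST FRAMING: venture file of the cell `pub-ymgap` (QuantumFields programme), track Y2 ROBUST-BALL, seat ds-4 g9.
WHAT THIS IS: a strong-coupling LATTICE theorem, uniform in the volume.  Gen 8 (`CentreTubeTierOne`) proved the countersigned currency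
`AreaLawCentreTubeFR N d β ε₀ ε₁ r` — ONE `(C, c)` for all tori: the fundamental Wilson loops of `⟨·⟩_{β, W_b + W, L}` obey
`|⟨W_{R×T}⟩| ≤ C^{2(R+T)} e^{−cRT}` for EVERY twist-blind `W_b` and EVERY `W` in the range-`r` tier-1 ball `ClusterDomainFR ε₀ ε₁ r` — under
`2(d−1)N|β| + K(d,r) ε₀ < 1` with the COUNTING constant `K(d,r) = ((2r+2)^d − 1) d (4r+3)^d` (`K(4,1) = 2 449 020`: a qualitative cell).
Here the SAME currency is proved under **`2(d−1)N|β| + √N ε₁ < 1`** (`areaLawCentreTubeFR_of_lip`) — the Lipschitz radius `ε₁` of the ball,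
NO counting constant, every range `r` (which now only sets the rate).  SU(2), `d = 4`: `6 β_W + √2 ε₁ < 1`; cells `(β_W, ε₁) = (1/8, 1/6)`,
`(1/10, 1/4)` for EVERY `r` and every `ε₀` (`su2_areaLawCentreTubeFR_lip_cell_*`) — radii of tier-1 size.
WHY IT WORKS (the one new idea over gen 8): the twist defect `D_X(k) = W_X(ζ_k U) − W_X(U)` of a polymer activity, although as a function
of the FLUX configuration it reads all fluxes of the `(2r+2)`-box of `X` (discrete Poincaré lemma, gen 8 — still used: it is what makes the
induced `ℤ_N` theory a flux interaction, with its layer symmetry and block factorisation), reads the LINK configuration `k` only through the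
links of `X`, and moves by at most `2√N · Lip_e(W_X)` (Frobenius diameter of a centre orbit, `suFrobDist_le`) when `k` changes at the single
link `e`.  The Dobrushin rows of the `ℤ_N` layer are therefore `≤ √N ∑_{X ∋ e} ∑_{e' ∈ X, e' ≠ e} Lip_{e'}(W_X) = √N Λ(e) ≤ √N ε₁`, the
cross-Lipschitz load of the ball (`linkRow_fluxDefect_le`).  The class of perturbations whose twist defect is a finite-range flux interaction
with LINK rows `≤ b` is `IsFluxLocalL m s b` (this seat's name, pattern of rb-theory's countersigned `IsFluxLocalW`; it CONTAINS `IsFluxLocalW m s b`: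
`IsFluxLocalW.isFluxLocalL`), and `abs_wilsonLoop_le_of_isFluxLocalL` is its windowed centre-tube bound at `c = 2(d−1)N|β| + b ≤ 1`.
HONEST LABEL (ROBUST-BALL-STATEMENT §6(c) + T43): strong-coupling lattice INEQUALITY (centre dominance + `ℤ_N`-layer area law); the
`β`-WINDOW `2(d−1)N|β| < 1` is NOT moved (only the radius); fundamental (nonzero-`N`-ality) loops; no `σ`-existence claim for non-Wilson
members; T15's unbounded-range loop terms stay outside; the rate `−log c/((2r+2)(2r+1))` is a door artefact; nothing continuum / spectral / Clay.

References for the blind mechanism AS PRINTED: J. Fröhlich, Phys. Lett. B 83 (1979) 195, Eq. (7)–(9); G. Mack, V. B. Petkova, Ann. Phys. 123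
(1979) 442, §2; B. Durhuus, J. Fröhlich, Comm. Math. Phys. 75 (1980) 103 (windowed peeling); Georgii 2011 Prop. 8.8 (Dobrushin rows).
-/

noncomputable section

open Finset MeasureTheory
open Literature.MathematicalPhysics.QuantumLattice (fundamentalRep)
open Literature.MathematicalPhysics.QuantumFieldTheory

namespace Summit.Ventures.YMGap.RobustBall

open ZN ZNFluxW

variable {d L N : ℕ}

/-! ### The class: finite-range flux-local twist defects with LINK rows -/

/-- **`IsFluxLocalL m s b W`** — the twist defect of `W` is a finite-range flux interaction with LINK ROWS `≤ b`: a twist-invariant part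
`c(U)` (arbitrary) plus finitely many terms `g_t(φ, U)` reading the flux configuration `φ = curl k` only on a plaquette support `supp t`
(`DependsOn`) inside a VERTICAL WINDOW (its `i`-links at cyclic `i`-distance `< m`, every `i`), such that `g_t(curl k, U)` reads the link
configuration `k` only through a link set `E t` (`j`-distance of its `i`-links `≤ s`, every `i, j`) and moves by at most `δ t e ≥ 0` when `k`
changes at the single link `e`, with LINK ROWS `½ ∑_{t : (y,i) ∈ E t} ∑_{y' ≠ y, (y',i) ∈ E t} δ t (y', i) ≤ b` (every `i`, every `i`-link `y`),
and `W.total (ζ_k · U) = c(U) + ∑_t g_t(curl k, U)` for every linkwise twist `k`.  Contains `IsFluxLocalW m s b` (`IsFluxLocalW.isFluxLocalL`).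
[folklore] -/
def IsFluxLocalL [NeZero L] [NeZero N] (m s : ℕ) (b : ℝ) (W : Perturbation d L N) : Prop :=
  ∃ (n : ℕ) (c : GaugeConfig d L (SUN N) → ℝ) (supp : Fin n → Finset (Plaquette d L))
    (gD : Fin n → (Plaquette d L → ZMod N) → GaugeConfig d L (SUN N) → ℝ) (E : Fin n → Finset (Edge d L))
    (δ : Fin n → Edge d L → ℝ),
    (∀ t U, DependsOn (fun φ => gD t φ U) (↑(supp t) : Set (Plaquette d L))) ∧
    (∀ t (k k' : Edge d L → ZMod N) (U : GaugeConfig d L (SUN N)), (∀ e ∈ E t, k e = k' e) →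
      gD t (flux k) U = gD t (flux k') U) ∧
    (∀ t e, 0 ≤ δ t e) ∧
    (∀ t (e : Edge d L) (k k' : Edge d L → ZMod N) (U : GaugeConfig d L (SUN N)), (∀ e', e' ≠ e → k e' = k' e') →
      |gD t (flux k) U - gD t (flux k') U| ≤ δ t e) ∧
    (∀ t (i : Fin d), ∀ y ∈ iLinks i (supp t), ∀ y' ∈ iLinks i (supp t), (y i - y' i).valMinAbs.natAbs < m) ∧
    (∀ t (i j : Fin d) (y y' : Site d L), (y, i) ∈ E t → (y', i) ∈ E t → jDist j y' y ≤ s) ∧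
    (∀ (i : Fin d) (y : Site d L), linkRow E δ i y / 2 ≤ b) ∧
    ∀ (k : Edge d L → ZMod N) (U : GaugeConfig d L (SUN N)), W.total (twistOf k * U) = c U + ∑ t, gD t (flux k) U

/-- Monotonicity in the window, the extent and the link rows. [folklore] -/
theorem IsFluxLocalL.mono [NeZero L] [NeZero N] {m m' s s' : ℕ} {b b' : ℝ} (hm : m ≤ m') (hs : s ≤ s') (hb : b ≤ b')
    {W : Perturbation d L N} (hW : IsFluxLocalL m s b W) : IsFluxLocalL m' s' b' W := by
  obtain ⟨n, c, supp, gD, E, δ, hdep, hE, hδ0, hδ, hwin, hext, hrow, hW⟩ := hW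
  exact ⟨n, c, supp, gD, E, δ, hdep, hE, hδ0, hδ, fun t i y hy y' hy' => (hwin t i y hy y' hy').trans_le hm,
    fun t i j y y' hy hy' => (hext t i j y y' hy hy').trans hs, fun i y => (hrow i y).trans hb, hW⟩

/-- **Any finite index type**: link-row defect data over an arbitrary `Fintype ι` gives `IsFluxLocalL` (reindex along `Fintype.equivFin`).
[folklore] -/
theorem isFluxLocalL_of_family [NeZero L] [NeZero N] {ι : Type*} [Fintype ι] {m s : ℕ} {b : ℝ} {W : Perturbation d L N}
    (c : GaugeConfig d L (SUN N) → ℝ) (supp : ι → Finset (Plaquette d L))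
    (gD : ι → (Plaquette d L → ZMod N) → GaugeConfig d L (SUN N) → ℝ) (E : ι → Finset (Edge d L)) (δ : ι → Edge d L → ℝ)
    (hdep : ∀ t U, DependsOn (fun φ => gD t φ U) (↑(supp t) : Set (Plaquette d L)))
    (hE : ∀ t (k k' : Edge d L → ZMod N) (U : GaugeConfig d L (SUN N)), (∀ e ∈ E t, k e = k' e) →
      gD t (flux k) U = gD t (flux k') U)
    (hδ0 : ∀ t e, 0 ≤ δ t e)
    (hδ : ∀ t (e : Edge d L) (k k' : Edge d L → ZMod N) (U : GaugeConfig d L (SUN N)), (∀ e', e' ≠ e → k e' = k' e') →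
      |gD t (flux k) U - gD t (flux k') U| ≤ δ t e)
    (hwin : ∀ t (i : Fin d), ∀ y ∈ iLinks i (supp t), ∀ y' ∈ iLinks i (supp t), (y i - y' i).valMinAbs.natAbs < m)
    (hext : ∀ t (i j : Fin d) (y y' : Site d L), (y, i) ∈ E t → (y', i) ∈ E t → jDist j y' y ≤ s)
    (hrow : ∀ (i : Fin d) (y : Site d L), linkRow E δ i y / 2 ≤ b)
    (hW : ∀ (k : Edge d L → ZMod N) (U : GaugeConfig d L (SUN N)), W.total (twistOf k * U) = c U + ∑ t, gD t (flux k) U) :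
    IsFluxLocalL m s b W := by
  classical
  set e := (Fintype.equivFin ι).symm with he
  refine ⟨Fintype.card ι, c, fun t => supp (e t), fun t => gD (e t), fun t => E (e t), fun t => δ (e t), fun t U => hdep (e t) U,
    fun t => hE (e t), fun t => hδ0 (e t), fun t => hδ (e t), fun t => hwin (e t), fun t => hext (e t), fun i y => ?_,
    fun k U => ?_⟩
  · rw [linkRow_equiv e E δ i y]; exact hrow i y
  · rw [hW k U]
    congr 1
    exact (Fintype.sum_equiv e _ _ fun t => rfl).symm

/-- **A twist-blind part costs nothing**: `W_b + W` has the same link-row defect data as `W`. [folklore] -/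
theorem IsFluxLocalL.twistBlind_add [NeZero L] [NeZero N] {m s : ℕ} {b : ℝ} {Wb W : Perturbation d L N}
    (hb : IsTwistBlind Wb) (hW : IsFluxLocalL m s b W) : IsFluxLocalL m s b (Wb + W) := by
  obtain ⟨n, c, supp, gD, E, δ, hdep, hE, hδ0, hδ, hwin, hext, hrow, hW⟩ := hW
  refine ⟨n, fun U => Wb.total U + c U, supp, gD, E, δ, hdep, hE, hδ0, hδ, hwin, hext, hrow, fun k U => ?_⟩
  rw [QuasiLocalGaugePerturbation.total_add, Pi.add_apply, hb k U, hW k U, add_assoc]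

/-- **Sums**: link-row defect families add (index `Fin n ⊕ Fin n'`): windows and extents combine by `max`, link rows add. [folklore] -/
theorem IsFluxLocalL.add [NeZero L] [NeZero N] {m m' s s' : ℕ} {b b' : ℝ} {W W' : Perturbation d L N}
    (hW : IsFluxLocalL m s b W) (hW' : IsFluxLocalL m' s' b' W') :
    IsFluxLocalL (max m m') (max s s') (b + b') (W + W') := by
  classical
  obtain ⟨n, c, supp, gD, E, δ, hdep, hE, hδ0, hδ, hwin, hext, hrow, hW⟩ := hW
  obtain ⟨n', c', supp', gD', E', δ', hdep', hE', hδ0', hδ', hwin', hext', hrow', hW'⟩ := hW'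
  refine isFluxLocalL_of_family (ι := Fin n ⊕ Fin n') (fun U => c U + c' U) (Sum.elim supp supp') (Sum.elim gD gD')
    (Sum.elim E E') (Sum.elim δ δ') ?_ ?_ ?_ ?_ ?_ ?_ (fun i y => ?_) (fun k U => ?_)
  · rintro (t | t) U
    · exact hdep t U
    · exact hdep' t U
  · rintro (t | t) k k' U h
    · exact hE t k k' U h
    · exact hE' t k k' U h
  · rintro (t | t) e
    · exact hδ0 t e
    · exact hδ0' t e
  · rintro (t | t) e k k' U h
    · exact hδ t e k k' U h
    · exact hδ' t e k k' U h
  · rintro (t | t) i y hy y' hy'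
    · exact (hwin t i y hy y' hy').trans_le (le_max_left _ _)
    · exact (hwin' t i y hy y' hy').trans_le (le_max_right _ _)
  · rintro (t | t) i j y y' hy hy'
    · exact (hext t i j y y' hy hy').trans (le_max_left _ _)
    · exact (hext' t i j y y' hy hy').trans (le_max_right _ _)
  · rw [linkRow_sum_elim, add_div]
    exact add_le_add (hrow i y) (hrow' i y)
  · rw [QuasiLocalGaugePerturbation.total_add, Pi.add_apply, hW k U, hW' k U, Fintype.sum_sum_type]
    simp only [Sum.elim_inl, Sum.elim_inr]
    ring

/-- **The gen-8 class is contained in the link-row class**: `IsFluxLocalW m s b W → IsFluxLocalL m s b W` (link set = all links of the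
plaquette support, variation `2 B_t`; half the link row is then exactly the support row). [folklore] -/
theorem IsFluxLocalW.isFluxLocalL [NeZero L] [NeZero N] {m s : ℕ} {b : ℝ} {W : Perturbation d L N} (hW : IsFluxLocalW m s b W) :
    IsFluxLocalL m s b W := by
  obtain ⟨n, c, supp, gD, B, hdep, hB0, hB, hwin, hext, hrow, hW⟩ := hW
  refine ⟨n, c, supp, gD, fun t => linksOf (supp t), fun t _ => 2 * B t, hdep, fun t k k' U h => ?_,
    fun t _ => mul_nonneg (by norm_num) (hB0 t), fun t e k k' U _ => ?_, hwin, fun t i j y y' hy hy' => ?_, fun i y => ?_, hW⟩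
  · exact hdep t U fun p hp => flux_congr_of_linksOf h (Finset.mem_coe.1 hp)
  · have h1 := hB t (flux k) U
    have h2 := hB t (flux k') U
    calc |gD t (flux k) U - gD t (flux k') U| ≤ |gD t (flux k) U| + |gD t (flux k') U| := abs_sub _ _
      _ ≤ B t + B t := add_le_add h1 h2
      _ = 2 * B t := by ring
  · exact hext t i j y (mk_mem_linksOf.1 hy) y' (mk_mem_linksOf.1 hy')
  · rw [linkRow_linksOf_eq supp B i y]; exact hrow i y

/-- **The windowed centre-tube bound for the link-row class** (`N ≥ 2`, `0 < m`, `0 < s`, `c = 2(d−1)N|β| + b ≤ 1`):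
`|⟨W_{R×T}⟩_{β,W,L}| ≤ (4 c^{⌈T/s⌉})^{#{r<R : m∣r}}`. [folklore] -/
theorem abs_wilsonLoop_le_of_isFluxLocalL [NeZero L] [NeZero N] (hN : 2 ≤ N) {β b c : ℝ} {m s : ℕ} (hm : 0 < m)
    (hs : 0 < s) (hc : 2 * ((d - 1 : ℕ) : ℝ) * |β| * N + b ≤ c) (hc1 : c ≤ 1) (W : Perturbation d L N)
    (hW : IsFluxLocalL m s b W) (x : Site d L) {i j : Fin d} (hij : i ≠ j) {R T : ℕ} (hR : 2 * R ≤ L) (hT : 2 * T ≤ L) :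
    |W.expectation (fundamentalRep (Fin N)) β (wilsonLoop (fundamentalRep (Fin N)) x i j R T)| ≤
      (4 * c ^ ((T + s - 1) / s)) ^ (selIdx m R).card := by
  obtain ⟨n, c₀, supp, gD, E, δ, hdep, hE, hδ0, hδ, hwin, hext, hrow, hW⟩ := hW
  exact abs_wilsonLoop_le_of_linkDefect hN W hW hdep hE hδ0 hδ hm hwin hs hext hrow hc hc1 x hij hR hT

/-! ### The twist defect of a range-`r` member has link rows `≤ √N Λ` -/

section Range

variable [NeZero L] [NeZero N]

/-- The link set of the defect term of `X`: the links of `X` (empty for polymers of diameter `> r`, whose activity vanishes). [folklore] -/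
def linkSetR (r : ℕ) (X : Finset (Site d L)) : Finset (Edge d L) := if polymerDiam X ≤ r then polymerEdges 1 X else ∅

/-- The per-link variation bound of the defect term of `X`: `2√N · Lip_e(W_X)` (zero for diameter `> r`). [folklore] -/
def lipVarR {W : Perturbation d L N} (w : LoadWitness W) (r : ℕ) (X : Finset (Site d L)) (e : Edge d L) : ℝ :=
  if polymerDiam X ≤ r then 2 * Real.sqrt N * w.lip X e else 0

omit [NeZero N] in
/-- Variation bounds are nonnegative. [folklore] -/
theorem lipVarR_nonneg {W : Perturbation d L N} (w : LoadWitness W) (r : ℕ) (X : Finset (Site d L)) (e : Edge d L) :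
    0 ≤ lipVarR w r X e := by
  unfold lipVarR; split_ifs
  · exact mul_nonneg (mul_nonneg (by norm_num) (Real.sqrt_nonneg _)) ((w.lip_spec X).nonneg e)
  · exact le_rfl

/-- **The defect of `X` reads the twist only through the links of `X`.** [folklore] -/
theorem fluxDefect_congr_of_linkSetR {r : ℕ} (hL : 2 * r + 2 < L) {W : Perturbation d L N} (hW : HasRange r W) (X : Finset (Site d L))
    {k k' : Edge d L → ZMod N} (U : GaugeConfig d L (SUN N)) (h : ∀ e ∈ linkSetR r X, k e = k' e) :
    fluxDefect W r X (flux k) U = fluxDefect W r X (flux k') U := by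
  rw [fluxDefect_flux hL hW X k U, fluxDefect_flux hL hW X k' U]
  by_cases hX : polymerDiam X ≤ r
  · rw [linkSetR, if_pos hX] at h
    rw [W.dependsOn X (fun e he => by
      show (twistOf k * U) e = (twistOf k' * U) e
      rw [Pi.mul_apply, Pi.mul_apply, twistOf, twistOf, h e (Finset.mem_coe.1 he)])]
  · simp [hW X (not_le.1 hX)]

/-- **The defect of `X` moves by at most `2√N · Lip_e(W_X)` when the twist changes at the single link `e`** (Frobenius diameter of `SU(N)`).
[folklore] -/
theorem abs_fluxDefect_sub_le_lipVarR {r : ℕ} (hL : 2 * r + 2 < L) {W : Perturbation d L N} (hW : HasRange r W) (w : LoadWitness W)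
    (X : Finset (Site d L)) (e : Edge d L) {k k' : Edge d L → ZMod N} (U : GaugeConfig d L (SUN N))
    (h : ∀ e', e' ≠ e → k e' = k' e') :
    |fluxDefect W r X (flux k) U - fluxDefect W r X (flux k') U| ≤ lipVarR w r X e := by
  rw [fluxDefect_flux hL hW X k U, fluxDefect_flux hL hW X k' U, lipVarR]
  by_cases hX : polymerDiam X ≤ r
  · rw [if_pos hX, sub_sub_sub_cancel_right]
    have hagree : ∀ e', e' ≠ e → (twistOf k * U) e' = (twistOf k' * U) e' := fun e' he' => by
      rw [Pi.mul_apply, Pi.mul_apply, twistOf, twistOf, h e' he']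
    refine ((w.lip_spec X).le e _ _ hagree).trans ?_
    calc w.lip X e * suFrobDist ((twistOf k * U) e) ((twistOf k' * U) e) ≤ w.lip X e * (2 * Real.sqrt N) :=
          mul_le_mul_of_nonneg_left (suFrobDist_le _ _) ((w.lip_spec X).nonneg e)
      _ = 2 * Real.sqrt N * w.lip X e := by ring
  · rw [if_neg hX]; simp [hW X (not_le.1 hX)]

omit [NeZero N] in
/-- The `i`-links of the link set of `X` have `j`-extent `≤ r`. [folklore] -/
theorem jDist_le_of_mem_linkSetR {r : ℕ} {X : Finset (Site d L)} (i j : Fin d) {y y' : Site d L} (hy : (y, i) ∈ linkSetR r X)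
    (hy' : (y', i) ∈ linkSetR r X) : jDist j y' y ≤ r := by
  unfold linkSetR at hy hy'
  split_ifs at hy hy' with hX
  · rw [mem_polymerEdges_one] at hy hy'
    exact (natAbs_valMinAbs_sub_le_polymerDiam hy hy' j).trans hX
  · simp at hy

omit [NeZero N] in
/-- **LINK ROWS OF A RANGE-`r` MEMBER**: `½ linkRow ≤ √N · Λ(y, i)` (the cross-Lipschitz load of the witness at the link). [folklore] -/
theorem linkRow_fluxDefect_le {r : ℕ} {W : Perturbation d L N} (w : LoadWitness W) (i : Fin d) (y : Site d L) :
    linkRow (linkSetR (d := d) (L := L) r) (lipVarR w r) i y / 2 ≤ Real.sqrt N * w.crossLipLoad 0 (y, i) := by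
  classical
  rw [div_le_iff₀ (by norm_num : (0 : ℝ) < 2), linkRow]
  -- Step 1: each polymer through `(y, i)` contributes at most `2√N ∑_{e ≠ (y,i), e ∈ links X} Lip_e(W_X)`
  have h1 : ∀ X ∈ (Finset.univ : Finset (Finset (Site d L))).filter (fun X => (y, i) ∈ linkSetR r X),
      ∑ y' ∈ Finset.univ.filter (fun y' => y' ≠ y ∧ (y', i) ∈ linkSetR r X), lipVarR w r X (y', i) ≤
        2 * Real.sqrt N * ∑ e ∈ (Finset.univ.erase ((y, i) : Edge d L)).filter (fun e => e ∈ polymerEdges 1 X), w.lip X e := by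
    intro X hX
    have hXr : polymerDiam X ≤ r := by
      have h := (Finset.mem_filter.1 hX).2
      unfold linkSetR at h
      split_ifs at h with hXr
      · exact hXr
      · simp at h
    simp only [lipVarR, linkSetR, if_pos hXr]
    rw [Finset.mul_sum]
    calc ∑ y' ∈ Finset.univ.filter (fun y' => y' ≠ y ∧ (y', i) ∈ polymerEdges 1 X), 2 * Real.sqrt N * w.lip X (y', i)
        = ∑ e ∈ (Finset.univ.filter (fun y' => y' ≠ y ∧ (y', i) ∈ polymerEdges 1 X)).image (fun y' => ((y', i) : Edge d L)),
            2 * Real.sqrt N * w.lip X e := by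
          rw [Finset.sum_image fun y₁ _ y₂ _ h => (Prod.ext_iff.1 h).1]
      _ ≤ ∑ e ∈ (Finset.univ.erase ((y, i) : Edge d L)).filter (fun e => e ∈ polymerEdges 1 X), 2 * Real.sqrt N * w.lip X e := by
          refine Finset.sum_le_sum_of_subset_of_nonneg (fun e he => ?_) fun e _ _ =>
            mul_nonneg (mul_nonneg (by norm_num) (Real.sqrt_nonneg _)) ((w.lip_spec X).nonneg e)
          obtain ⟨y', hy', rfl⟩ := Finset.mem_image.1 he
          rw [Finset.mem_filter] at hy'
          exact Finset.mem_filter.2 ⟨Finset.mem_erase.2 ⟨fun h => hy'.2.1 (Prod.ext_iff.1 h).1, Finset.mem_univ _⟩, hy'.2.2⟩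
  refine (Finset.sum_le_sum h1).trans ?_
  rw [← Finset.mul_sum]
  -- Step 2: swap the sums: `∑_{X ∋ (y,i)} ∑_{e ≠ (y,i), e ∈ X} Lip = Λ(y, i)`
  have h2 : ∑ X ∈ (Finset.univ : Finset (Finset (Site d L))).filter (fun X => (y, i) ∈ linkSetR r X),
      ∑ e ∈ (Finset.univ.erase ((y, i) : Edge d L)).filter (fun e => e ∈ polymerEdges 1 X), w.lip X e ≤
        w.crossLipLoad 0 (y, i) := by
    calc ∑ X ∈ (Finset.univ : Finset (Finset (Site d L))).filter (fun X => (y, i) ∈ linkSetR r X),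
          ∑ e ∈ (Finset.univ.erase ((y, i) : Edge d L)).filter (fun e => e ∈ polymerEdges 1 X), w.lip X e
        ≤ ∑ X ∈ polymersThroughEdge ((y, i) : Edge d L),
            ∑ e ∈ (Finset.univ.erase ((y, i) : Edge d L)).filter (fun e => e ∈ polymerEdges 1 X), w.lip X e := by
          refine Finset.sum_le_sum_of_subset_of_nonneg (fun X hX => ?_) fun X _ _ =>
            Finset.sum_nonneg fun e _ => (w.lip_spec X).nonneg e
          have h := (Finset.mem_filter.1 hX).2
          unfold linkSetR at h
          split_ifs at h with hXr
          · exact mem_polymersThroughEdge_iff.2 (mem_polymerEdges_one.1 h)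
          · simp at h
      _ = ∑ X ∈ polymersThroughEdge ((y, i) : Edge d L), ∑ e ∈ Finset.univ.erase ((y, i) : Edge d L),
            (if e ∈ polymerEdges 1 X then w.lip X e else 0) := by
          simp only [Finset.sum_filter]
      _ = ∑ e ∈ Finset.univ.erase ((y, i) : Edge d L), ∑ X ∈ polymersThroughEdge ((y, i) : Edge d L),
            (if e ∈ polymerEdges 1 X then w.lip X e else 0) := Finset.sum_comm
      _ = w.crossLipLoad 0 (y, i) := by
          rw [LoadWitness.crossLipLoad]
          refine Finset.sum_congr rfl fun e _ => ?_
          rw [LoadWitness.crossLip, Finset.sum_filter]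
          simp
  have h2N : (0 : ℝ) ≤ 2 * Real.sqrt N := mul_nonneg (by norm_num) (Real.sqrt_nonneg _)
  exact (mul_le_mul_of_nonneg_left h2 h2N).trans_eq (by ring)

/-- **EVERY RANGE-`r` MEMBER IS IN THE LINK-ROW CENTRE TUBE** with link rows `√N ε₁` whenever its cross-Lipschitz loads are `≤ ε₁`
(`2r + 2 < L`): `IsFluxLocalL (2r+2) (2r+1) (√N ε₁) W`. [folklore] -/
theorem isFluxLocalL_of_hasRange {r : ℕ} (hL : 2 * r + 2 < L) {W : Perturbation d L N} (hW : HasRange r W) (w : LoadWitness W)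
    {ε₁ : ℝ} (hΛ : ∀ e, w.crossLipLoad 0 e ≤ ε₁) : IsFluxLocalL (2 * r + 2) (2 * r + 1) (Real.sqrt N * ε₁) W :=
  isFluxLocalL_of_family (ι := Finset (Site d L)) W.total (boxSupp r) (fluxDefect W r) (linkSetR r) (lipVarR w r)
    (fun X U => dependsOn_fluxDefect hL hW X U) (fun X _ _ U h => fluxDefect_congr_of_linkSetR hL hW X U h) (lipVarR_nonneg w r)
    (fun X e _ _ U h => abs_fluxDefect_sub_le_lipVarR hL hW w X e U h)
    (fun _ i _ hy _ hy' => Nat.lt_succ_of_le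
      (natAbs_valMinAbs_sub_le_of_polyBox (polyBox_of_mem_iLinks i hy) (polyBox_of_mem_iLinks i hy') i))
    (fun X i j _ _ hy hy' => (jDist_le_of_mem_linkSetR i j hy hy').trans (by omega))
    (fun i y => (linkRow_fluxDefect_le w i y).trans (mul_le_mul_of_nonneg_left (hΛ _) (Real.sqrt_nonneg _)))
    (fun k U => total_twist_eq_fluxDefect hL hW k U)

/-- **RANGE `r` + CROSS-LIPSCHITZ LOAD ONLY — windowed centre-tube bound** (`N ≥ 2`, `2r + 2 < L`): for EVERY twist-blind `W_b` and EVERY `W` of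
range `r` with a load witness whose CROSS-Lipschitz loads are `≤ ε₁` (no oscillation load, no self-Lipschitz load asked), at
`c = 2(d−1)N|β| + √N ε₁ ≤ 1`: `|⟨W_{R×T}⟩_{β, W_b + W, L}| ≤ (4 c^{⌈T/(2r+1)⌉})^{#{ρ<R : (2r+2)∣ρ}}`. [folklore] -/
theorem areaLaw_of_hasRange_crossLip_add_twistBlind (hN : 2 ≤ N) {r : ℕ} (hL : 2 * r + 2 < L) {β ε₁ c : ℝ}
    {Wb W : Perturbation d L N} (hb : IsTwistBlind Wb) (hW : HasRange r W) (w : LoadWitness W) (hΛ : ∀ e, w.crossLipLoad 0 e ≤ ε₁)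
    (hc : 2 * ((d - 1 : ℕ) : ℝ) * |β| * N + Real.sqrt N * ε₁ ≤ c) (hc1 : c ≤ 1) (x : Site d L) {i j : Fin d} (hij : i ≠ j)
    {R T : ℕ} (hR : 2 * R ≤ L) (hT : 2 * T ≤ L) :
    |(Wb + W).expectation (fundamentalRep (Fin N)) β (wilsonLoop (fundamentalRep (Fin N)) x i j R T)| ≤
      (4 * c ^ ((T + (2 * r + 1) - 1) / (2 * r + 1))) ^ (selIdx (2 * r + 2) R).card :=
  abs_wilsonLoop_le_of_isFluxLocalL hN (by omega) (by omega) hc hc1 _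
    (IsFluxLocalL.twistBlind_add hb (isFluxLocalL_of_hasRange hL hW w hΛ)) x hij hR hT

/-- **EVERY MEMBER OF THE RANGE-`r` TIER-1 BALL IS IN THE LINK-ROW CENTRE TUBE** (`2r + 2 < L`):
`W ∈ ClusterDomainFR ε₀ ε₁ r → IsFluxLocalL (2r+2) (2r+1) (√N ε₁) W` — the Lipschitz radius `ε₁` is the row, the oscillation load `ε₀` idle,
NO counting constant. [folklore] -/
theorem isFluxLocalL_of_clusterDomainFR {r : ℕ} (hL : 2 * r + 2 < L) {ε₀ ε₁ : ℝ} {W : Perturbation d L N}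
    (hW : W ∈ ClusterDomainFR ε₀ ε₁ r) : IsFluxLocalL (2 * r + 2) (2 * r + 1) (Real.sqrt N * ε₁) W := by
  obtain ⟨hR, w, -, hlip⟩ := hW
  exact isFluxLocalL_of_hasRange hL hR w fun e => le_trans (le_add_of_nonneg_left (selfLipLoad_nonneg w 0 e)) (hlip e)

/-- **THE TIER-1 BALL AROUND EVERY CENTRE-BLIND ACTION — windowed centre-tube bound with LINK rows** (`N ≥ 2`, `2r + 2 < L`): for EVERY
twist-blind `W_b` (any size, any range) and EVERY `W ∈ ClusterDomainFR ε₀ ε₁ r`, at `c = 2(d−1)N|β| + √N ε₁ ≤ 1`: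
`|⟨W_{R×T}⟩_{β, W_b + W, L}| ≤ (4 c^{⌈T/(2r+1)⌉})^{#{ρ<R : (2r+2)∣ρ}}`. [folklore] -/
theorem areaLaw_clusterDomainFR_add_twistBlind_lip (hN : 2 ≤ N) {r : ℕ} (hL : 2 * r + 2 < L) {β ε₀ ε₁ c : ℝ}
    {Wb W : Perturbation d L N} (hb : IsTwistBlind Wb) (hW : W ∈ ClusterDomainFR ε₀ ε₁ r)
    (hc : 2 * ((d - 1 : ℕ) : ℝ) * |β| * N + Real.sqrt N * ε₁ ≤ c) (hc1 : c ≤ 1) (x : Site d L) {i j : Fin d} (hij : i ≠ j)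
    {R T : ℕ} (hR : 2 * R ≤ L) (hT : 2 * T ≤ L) :
    |(Wb + W).expectation (fundamentalRep (Fin N)) β (wilsonLoop (fundamentalRep (Fin N)) x i j R T)| ≤
      (4 * c ^ ((T + (2 * r + 1) - 1) / (2 * r + 1))) ^ (selIdx (2 * r + 2) R).card :=
  abs_wilsonLoop_le_of_isFluxLocalL hN (by omega) (by omega) hc hc1 _
    (IsFluxLocalL.twistBlind_add hb (isFluxLocalL_of_clusterDomainFR hL hW)) x hij hR hT

/-- **MEMBERS COMBINE: any twist-blind action + the `1×2`-rectangle (Symanzik) term + any member of the range-`r` tier-1 ball** (`N ≥ 2`,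
`1 ≤ r`, `2r + 2 < L`): at `c = 2(d−1)N|β| + 25 d(d−1)|τ| + √N ε₁ ≤ 1`, window `2r+2`, extent `2r+1`:
`|⟨W_{R×T}⟩_{β, W_b + W_rect(τ) + W, L}| ≤ (4 c^{⌈T/(2r+1)⌉})^{#{ρ<R : (2r+2)∣ρ}}` (link rows add: `IsFluxLocalL.add`). [folklore] -/
theorem areaLaw_rectangle_add_clusterDomainFR (hN : 2 ≤ N) {r : ℕ} (hr : 1 ≤ r) (hL : 2 * r + 2 < L) {β τ ε₀ ε₁ c : ℝ}
    {Wb W : Perturbation d L N} (hb : IsTwistBlind Wb) (hW : W ∈ ClusterDomainFR ε₀ ε₁ r)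
    (hc : 2 * ((d - 1 : ℕ) : ℝ) * |β| * N + (25 * ((d : ℝ) * ((d : ℝ) - 1)) * |τ| + Real.sqrt N * ε₁) ≤ c) (hc1 : c ≤ 1)
    (x : Site d L) {i j : Fin d} (hij : i ≠ j) {R T : ℕ} (hR : 2 * R ≤ L) (hT : 2 * T ≤ L) :
    |(Wb + termPerturbation (rectFamily d L N τ) + W).expectation (fundamentalRep (Fin N)) β
        (wilsonLoop (fundamentalRep (Fin N)) x i j R T)| ≤
      (4 * c ^ ((T + (2 * r + 1) - 1) / (2 * r + 1))) ^ (selIdx (2 * r + 2) R).card := by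
  have h := ((isFluxLocalW_twistBlind_add_rectFamily τ hb).isFluxLocalL.add (isFluxLocalL_of_clusterDomainFR hL hW)).mono
    (m' := 2 * r + 2) (s' := 2 * r + 1) (max_le (by omega) le_rfl) (max_le (by omega) le_rfl) le_rfl
  exact abs_wilsonLoop_le_of_isFluxLocalL hN (by omega) (by omega) hc hc1 _ h x hij hR hT

end Range

/-! ### The currency with the quantitative hypothesis -/

/-- **THE TIER-1 BALL AROUND EVERY CENTRE-BLIND ACTION — `AreaLawCentreTubeFR N d β ε₀ ε₁ r` whenever `2(d−1)N|β| + √N ε₁ < 1`**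
(`N ≥ 2`; every `d`, `r`, `ε₀`): ONE pair `(C, c)` for all tori (`C = max 2 e^{c(r+1)²}`, `c = −log max(2(d−1)N|β| + √N ε₁, 1/2)/((2r+2)(2r+1))`;
small tori `L ≤ 2r+2` absorbed into `C`).  No counting constant. [cite: Frohlich1979ZN, Eq. (7)–(9)] -/
theorem areaLawCentreTubeFR_of_lip [NeZero N] (hN : 2 ≤ N) {β ε₁ : ℝ} (ε₀ : ℝ) (r : ℕ)
    (hβ : 2 * ((d - 1 : ℕ) : ℝ) * |β| * N + Real.sqrt N * ε₁ < 1) : AreaLawCentreTubeFR N d β ε₀ ε₁ r := by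
  set c₀ := max (2 * ((d - 1 : ℕ) : ℝ) * |β| * N + Real.sqrt N * ε₁) (1 / 2) with hc₀
  have hc0 : 0 < c₀ := lt_max_of_lt_right (by norm_num)
  have hc1 : c₀ < 1 := max_lt hβ (by norm_num)
  have hcle : 2 * ((d - 1 : ℕ) : ℝ) * |β| * N + Real.sqrt N * ε₁ ≤ c₀ := le_max_left _ _
  set c := -Real.log c₀ / (((2 * r + 2 : ℕ) : ℝ) * ((2 * r + 1 : ℕ) : ℝ)) with hc
  have hcpos : 0 < c := div_pos (neg_pos.2 (Real.log_neg hc0 hc1)) (by positivity)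
  set C := max 2 (Real.exp (c * ((r : ℝ) + 1) ^ 2)) with hC
  have hC2 : (2 : ℝ) ≤ C := le_max_left _ _
  have hC1 : (1 : ℝ) ≤ C := le_trans (by norm_num) hC2
  refine ⟨C, c, hcpos, fun L _ Wb W hb hW x i j R T hij hR1 hT1 hRL hTL => ?_⟩
  by_cases hL : 2 * r + 2 < L
  · -- large torus: the windowed bound
    have h1 := areaLaw_clusterDomainFR_add_twistBlind_lip hN hL hb hW hcle hc1.le x hij hRL hTL
    have h2 := windowBound_le_areaLawShape hc0 hc1.le (m := 2 * r + 2) (s := 2 * r + 1) (by omega) (by omega) R T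
    refine h1.trans (h2.trans ?_)
    have e : -(-Real.log c₀ / (((2 * r + 2 : ℕ) : ℝ) * ((2 * r + 1 : ℕ) : ℝ))) * ((R : ℝ) * T) = -c * (R * T) := by rw [hc]
    rw [e]
    exact mul_le_mul_of_nonneg_right (pow_le_pow_left₀ (by norm_num) hC2 _) (Real.exp_pos _).le
  · -- small torus: `R, T ≤ r + 1`, the loop is bounded by `1 ≤ C^{2(R+T)} e^{−c RT}`
    have hRr : R ≤ r + 1 := by omega
    have hTr : T ≤ r + 1 := by omega
    refine (abs_expectation_wilsonLoop_le_one _ β x i j R T).trans ?_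
    have hRT : (R : ℝ) * T ≤ ((r : ℝ) + 1) ^ 2 := by
      have h1 : (R : ℝ) ≤ r + 1 := by exact_mod_cast hRr
      have h2 : (T : ℝ) ≤ r + 1 := by exact_mod_cast hTr
      nlinarith [Nat.cast_nonneg (α := ℝ) R, Nat.cast_nonneg (α := ℝ) T]
    have hexp : (1 : ℝ) ≤ Real.exp (c * ((r : ℝ) + 1) ^ 2) * Real.exp (-c * (R * T)) := by
      rw [← Real.exp_add]; exact Real.one_le_exp (by nlinarith)
    have hCpow : Real.exp (c * ((r : ℝ) + 1) ^ 2) ≤ C ^ (2 * (R + T)) :=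
      (le_max_right _ _).trans (le_self_pow₀ hC1 (by omega))
    exact hexp.trans (mul_le_mul_of_nonneg_right hCpow (Real.exp_pos _).le)

end Summit.Ventures.YMGap.RobustBall

end
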